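import Literature.MathematicalPhysics.QuantumFieldTheory.Balaban1983to89.Node00.OpsYGauge
import Literature.Analysis.Calculus.ExpDuhamel

/-!
# `Balaban1983to89.B9Thm31SiteCoerciveReg335CubeY` — T. Bałaban, *Propagators for lattice gauge theories in a background field*, Commun. Math.
# Phys. **99** (1985) 389–434 [Balaban1985BackgroundPropagators] (3.35) p. 396 with [4] (2.1)–(2.4) p. 224: EVERY BLOCK OF `𝔅` SITS IN A CLASS CUBE OF
# ITS OWN LEVEL (its big block), and in that cube's (3.35) gauge every bond variable with both ends in the cube is `(e^{C L^{−j}} − 1)`-close to `1`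
# and a contraction pair (`C = c·M·α₀`) — the (3.35) datum of def-Y's class `(bg9K (M_N ℂ) G i).Reg335` read at the scale of a block
# (file 3a of the site-operator coercivity set)

statement-level skeleton of published theorems with citation tags; proofs where landed; nothing here is a claim about the Yang–Mills mass gap

THE PRINT (verbatim).  p. 396: *«At first let us introduce a class of cubes. For each cube □ of this class there exists a unique index j … □ ⊂ Bʲ(Λ_j) ∪
B^{j+1}(Λ_{j+1}), □ ∩ Bʲ(Λ_j) ≠ ∅, and □ is a union of several big blocks of the lattice T_{L^{−j}} … for an arbitrary cube □ of the described above class,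
and for a configuration U there exists a gauge transformation u on □ such that U^u = e^{iηA}. and if the index of □ is j, then |A| < O(1)Mα₀(Lʲη)⁻¹,
|∇^ηA| < O(1)Mα₀(Lʲη)⁻² on □ (3.35)»*; [4] (2.1) p. 224: *«Ω_j … is a sum of big blocks»*.

WHY THIS FILE (cell `pub-ymgap`, Track A node N06 [B9], width seat `pub-ymgap-dag-n06-w1`, OFFER-A).  Files 1–2b reduce the uniform coercivity of def-Y's
`Δ′_a(U)` to two smallness letters of a gauge on each block `s ∈ 𝔅` of NODE 00's carrier.  THIS FILE produces the gauge and the first letter from def-Y's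
typed class (3.35) (`B9BackgroundsKLevelV1.bg9K`, cube class `cubeClass396`, per-cube datum `B9Eq335RegularityClasses.Reg335Cube`): (i) the BIG `j`-BLOCK
containing a block `s` of level `j` has constant level `j` ([4] (2.1) at levels `j` and `j+1`), hence is a class cube of index `j`
(`bigBlock_mem_cubeClass396`); (ii) unpacking its (3.35) datum `(u, A)`: for every bond `⟨x, x+e_μ⟩` with BOTH ends in the cube, the gauged variable
`U^u(b) = e^{iηA_μ(x)}` satisfies `|U^u(b) − 1| ≤ e^{η|A_μ(x)|} − 1 ≤ e^{C·L^{−j}} − 1` (`η∕(Lʲη) = L^{−j}`) and `|U^u(b)|, |U^u(b)⁻¹| ≤ 1` (`U` is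
`G`-valued, `G ≤ U(N)`, and `u` is a contraction pair on the cube).  The coordinate bookkeeping between NODE 00's box chart and the torus (the box of a block,
of its big block, the torus cube they chart to) is recorded once here for files 3b–3c.
PRIOR ART DECLARED: dag-n06-j's `B9Eq335PlaquetteAtLettersY` unpacks the same datum for PLAQUETTES (`norm_holY_sub_one_le_of_reg335`); the per-bond
reading here is the simpler half of that bookkeeping (one exponential instead of four: `Literature.Analysis.Calculus.norm_exp_sub_one_le`); def-Y's class,
chart and gauge action are used BY NAME; nothing of either is restated.

WHAT IS PROVED (sorry-free; 0 `def`; [folklore] integer ∕ residue bookkeeping + one exponential estimate; nothing of [B9] asserted).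
* §1 box-chart coordinates of a block `s ∈ 𝔅` (corner `c`, side `n = L^{j(s)}`) and of its big block (corner `C`, side `B = bigSide j`): `coord_bounds_of_blkOf`,
  `blkOf_eq_of_coord_bounds`, `blk_big_eq_of_blkOf`, `bigCoord_bounds_of_blkOf`, `bigCorner_nonneg`, `corner_add_side_le_big`, `bigCorner_add_side_le_N0`,
  ★ `lev_eq_of_blk_bigSide_eq` (levels are constant on big blocks of their own level).
* §2 the torus cube: `val_bigCornerSite`, `mem_bigCube_of_coord_bounds`, `coord_bounds_of_mem_bigCube`, ★ `levV1_eq_of_mem_bigCube`,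
  ★★ `bigCube_mem_cubeClass396` (the big block of `s` is a class cube of index `j(s)`), `symm_mem_bigCube_of_blkOf` (sites of `s` chart into it).
* §3 the (3.35) gauge on the cube (`𝔸 = M_N(ℂ)`, `G ≤ U(N)`): `val_fluct_eq_exp`, `norm_fluct_sub_one_le`, ★★★ `gauged_bond_near_one_of_reg335Cube`
  (both ends in the cube ⇒ `|U^u(b) − 1| ≤ e^{C(η∕ξ)} − 1`, `|U^u(b)| ≤ 1`, `|U^u(b)⁻¹| ≤ 1`), ★★★ `exists_gauge_of_reg335_blk` — for a block `s ∈ 𝔅`: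
  a gauge `u` with `u` a contraction pair at every torus point of the big cube and the three bond facts for every bond with both ends in it,
  `ρ_j = e^{C·L^{−j}} − 1`, `C = c·M·α₀`.
HONEST SCOPE.  Elementary; no estimate of [B9] asserted; NOT a node discharge, NOT summit progress; count-neutral; one finite lattice at a time; nothing
continuum ∕ OS ∕ mass gap ∕ Clay.
-/

noncomputable section

namespace Literature.MathematicalPhysics.QuantumFieldTheory.Balaban1983to89.B9Thm31SiteCoerciveReg335CubeY

open Literature.MathematicalPhysics.QuantumFieldTheory.Balaban1983to89
open Node00 B6KLevelCensusIndexV1 B6Geom246MultiLevelBox B6MultiLevelBoxOperator B6MultiLevelTorusOperator B6GlobalChartV1 B9BackgroundsKLevelV1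
  B9Eq39Adjoint
open Literature.MathematicalPhysics.QuantumFieldTheory.Balaban1983to89.B4Reflection242 (boxDom blk mem_boxDom)
open Literature.MathematicalPhysics.QuantumFieldTheory.Balaban1983to89.B4Thm110ZeroBox (blk_blk)
open scoped Matrix

variable {d ℓ : ℕ} {hd : 1 ≤ d + 1} {hL : Odd (ℓ + 1) ∧ 1 < ℓ + 1} {b₀ b₁ : ℝ}

/-! ## §1 Box-chart coordinates of a block of `𝔅` and of its big block -/

section Coords

variable (i : KIdx d ℓ hd hL b₀ b₁)

/-- the side `n = L^{j(s)}` of a block is positive. [cite: Balaban1984PropagatorsII, (2.1) p.224, bookkeeping] -/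
theorem side_pos (s : BlkY i) : (0 : ℤ) < (((ℓ + 1) ^ s.1.1 : ℕ) : ℤ) := by positivity

/-- a site of the block `s` lies in the coordinate box `[c, c + n)` of the block's corner. [cite: Balaban1984PropagatorsII, (2.1) p.224, dictionary] -/
theorem coord_bounds_of_blkOf {z : SiteY i} {s : BlkY i} (h : blkOf i.D.toDomains z = s) (μ : Fin (d + 1)) :
    (blkCornerY i s).1 μ ≤ z.1 μ ∧ z.1 μ < (blkCornerY i s).1 μ + (((ℓ + 1) ^ s.1.1 : ℕ) : ℤ) := by
  have hb : blk ((ℓ + 1) ^ s.1.1) z.1 = s.1.2 := (blkOf_eq_iff_blk i.D.toDomains).1 h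
  have hμ : z.1 μ / (((ℓ + 1) ^ s.1.1 : ℕ) : ℤ) = s.1.2 μ := congrFun hb μ
  show (((ℓ + 1) ^ s.1.1 : ℕ) : ℤ) * s.1.2 μ ≤ z.1 μ ∧ z.1 μ < (((ℓ + 1) ^ s.1.1 : ℕ) : ℤ) * s.1.2 μ + (((ℓ + 1) ^ s.1.1 : ℕ) : ℤ)
  rw [← hμ]
  exact ⟨Int.mul_ediv_self_le (side_pos i s).ne', Int.lt_mul_ediv_self_add (side_pos i s)⟩

/-- conversely a point of the torus box with coordinates in `[c, c + n)` lies in `s`. [cite: Balaban1984PropagatorsII, (2.1) p.224, dictionary] -/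
theorem blkOf_eq_of_coord_bounds {w : SiteY i} {s : BlkY i}
    (h : ∀ μ, (blkCornerY i s).1 μ ≤ w.1 μ ∧ w.1 μ < (blkCornerY i s).1 μ + (((ℓ + 1) ^ s.1.1 : ℕ) : ℤ)) : blkOf i.D.toDomains w = s := by
  rw [blkOf_eq_iff_blk]
  funext μ
  obtain ⟨h1, h2⟩ := h μ
  change (((ℓ + 1) ^ s.1.1 : ℕ) : ℤ) * s.1.2 μ ≤ w.1 μ at h1
  change w.1 μ < (((ℓ + 1) ^ s.1.1 : ℕ) : ℤ) * s.1.2 μ + (((ℓ + 1) ^ s.1.1 : ℕ) : ℤ) at h2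
  show w.1 μ / (((ℓ + 1) ^ s.1.1 : ℕ) : ℤ) = s.1.2 μ
  have hn := side_pos i s
  have e : w.1 μ = (w.1 μ - (((ℓ + 1) ^ s.1.1 : ℕ) : ℤ) * s.1.2 μ) + s.1.2 μ * (((ℓ + 1) ^ s.1.1 : ℕ) : ℤ) := by ring
  rw [e, Int.add_mul_ediv_right _ _ hn.ne', Int.ediv_eq_zero_of_lt (by linarith) (by linarith), zero_add]

/-- the big-block label is constant on `s`: `blk B z = blk (M_hL) (label of s)` for `z ∈ s`, `B = bigSide j = n·(M_h L)`. [cite: Balaban1984PropagatorsII, (2.1) p.224, dictionary] -/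
theorem blk_big_eq_of_blkOf {z : SiteY i} {s : BlkY i} (h : blkOf i.D.toDomains z = s) :
    blk (bigSide ℓ i.Mh s.1.1) z.1 = blk (i.Mh * (ℓ + 1)) s.1.2 := by
  rw [bigSide_eq, ← blk_blk, (blkOf_eq_iff_blk i.D.toDomains).1 h]

/-- the big-block box of a site of `s`: `C ≤ z < C + B` with `C = B·blk_B(c)`. [cite: Balaban1984PropagatorsII, (2.1) p.224, dictionary] -/
theorem bigCoord_bounds_of_blkOf {z : SiteY i} {s : BlkY i} (h : blkOf i.D.toDomains z = s) (μ : Fin (d + 1)) :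
    ((bigSide ℓ i.Mh s.1.1 : ℕ) : ℤ) * blk (bigSide ℓ i.Mh s.1.1) (blkCornerY i s).1 μ ≤ z.1 μ ∧
      z.1 μ < ((bigSide ℓ i.Mh s.1.1 : ℕ) : ℤ) * blk (bigSide ℓ i.Mh s.1.1) (blkCornerY i s).1 μ + ((bigSide ℓ i.Mh s.1.1 : ℕ) : ℤ) := by
  have hc : blkOf i.D.toDomains (blkCornerY i s) = s := blkOf_corner i.D.toDomains s
  have hB : blk (bigSide ℓ i.Mh s.1.1) (blkCornerY i s).1 μ = z.1 μ / ((bigSide ℓ i.Mh s.1.1 : ℕ) : ℤ) := by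
    have e := congrFun (blk_big_eq_of_blkOf i h) μ
    have e' := congrFun (blk_big_eq_of_blkOf i hc) μ
    rw [← e] at e'
    exact e'
  have hBpos : (0 : ℤ) < ((bigSide ℓ i.Mh s.1.1 : ℕ) : ℤ) := by
    have := one_le_bigSide (ℓ := ℓ) (le_trans (by norm_num) i.hM8) s.1.1
    exact_mod_cast this
  rw [hB]
  exact ⟨Int.mul_ediv_self_le hBpos.ne', Int.lt_mul_ediv_self_add hBpos⟩

/-- the big corner is non-negative. [cite: Balaban1984PropagatorsII, (2.1) p.224, bookkeeping] -/
theorem bigCorner_nonneg (s : BlkY i) (μ : Fin (d + 1)) : 0 ≤ ((bigSide ℓ i.Mh s.1.1 : ℕ) : ℤ) * blk (bigSide ℓ i.Mh s.1.1) (blkCornerY i s).1 μ := by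
  refine mul_nonneg (by positivity) (Int.ediv_nonneg ?_ (by positivity))
  exact ((mem_boxDom.1 (blkCornerY i s).2) μ).1

/-- the block `s` sits inside its big block: `c + n ≤ C + B`. [cite: Balaban1984PropagatorsII, (2.1) p.224, bookkeeping] -/
theorem corner_add_side_le_big (s : BlkY i) (μ : Fin (d + 1)) :
    (blkCornerY i s).1 μ + (((ℓ + 1) ^ s.1.1 : ℕ) : ℤ)
      ≤ ((bigSide ℓ i.Mh s.1.1 : ℕ) : ℤ) * blk (bigSide ℓ i.Mh s.1.1) (blkCornerY i s).1 μ + ((bigSide ℓ i.Mh s.1.1 : ℕ) : ℤ) := by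
  have hc : blkOf i.D.toDomains (blkCornerY i s) = s := blkOf_corner i.D.toDomains s
  have h2 := (bigCoord_bounds_of_blkOf i hc μ).2
  -- `c = n·β`, `C + B = n·(M_hL)·(β_B + 1)`: divide the strict inequality by `n`
  have hnpos : (0 : ℤ) < (((ℓ + 1) ^ s.1.1 : ℕ) : ℤ) := side_pos i s
  have hcμ : (blkCornerY i s).1 μ = (((ℓ + 1) ^ s.1.1 : ℕ) : ℤ) * s.1.2 μ := rfl
  have hBn : ((bigSide ℓ i.Mh s.1.1 : ℕ) : ℤ) = (((ℓ + 1) ^ s.1.1 : ℕ) : ℤ) * ((i.Mh * (ℓ + 1) : ℕ) : ℤ) := by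
    rw [bigSide_eq]; push_cast; ring
  rw [hcμ, hBn] at h2 ⊢
  have h2' : (((ℓ + 1) ^ s.1.1 : ℕ) : ℤ) * s.1.2 μ
      < (((ℓ + 1) ^ s.1.1 : ℕ) : ℤ) * (((i.Mh * (ℓ + 1) : ℕ) : ℤ) * blk (bigSide ℓ i.Mh s.1.1) (blkCornerY i s).1 μ + ((i.Mh * (ℓ + 1) : ℕ) : ℤ)) := by
    linarith
  have h3 : s.1.2 μ < ((i.Mh * (ℓ + 1) : ℕ) : ℤ) * blk (bigSide ℓ i.Mh s.1.1) (blkCornerY i s).1 μ + ((i.Mh * (ℓ + 1) : ℕ) : ℤ) :=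
    lt_of_mul_lt_mul_left h2' hnpos.le
  have h4 : s.1.2 μ + 1 ≤ ((i.Mh * (ℓ + 1) : ℕ) : ℤ) * blk (bigSide ℓ i.Mh s.1.1) (blkCornerY i s).1 μ + ((i.Mh * (ℓ + 1) : ℕ) : ℤ) := h3
  nlinarith

/-- big blocks tile the torus box: `C + B ≤ N₀`. [cite: Balaban1984PropagatorsII, (2.1) p.224 («M·Lʲ ∣ N₀»), bookkeeping] -/
theorem bigCorner_add_side_le_N0 (s : BlkY i) (μ : Fin (d + 1)) :
    ((bigSide ℓ i.Mh s.1.1 : ℕ) : ℤ) * blk (bigSide ℓ i.Mh s.1.1) (blkCornerY i s).1 μ + ((bigSide ℓ i.Mh s.1.1 : ℕ) : ℤ)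
      ≤ ((N0 ℓ i.Mh i.k i.P' μ : ℕ) : ℤ) := by
  have hjk : s.1.1 ≤ i.k := (scale_bounds i.D.toDomains s).2
  have hBpos : (0 : ℤ) < ((bigSide ℓ i.Mh s.1.1 : ℕ) : ℤ) := by
    have := one_le_bigSide (ℓ := ℓ) (le_trans (by norm_num) i.hM8) s.1.1; exact_mod_cast this
  -- `N₀ = B · q` with `q = L^{k−j}·P′`
  have hN : ((N0 ℓ i.Mh i.k i.P' μ : ℕ) : ℤ) = ((bigSide ℓ i.Mh s.1.1 : ℕ) : ℤ) * (((ℓ + 1) ^ (i.k - s.1.1) * i.P' μ : ℕ) : ℤ) := by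
    have e : N0 ℓ i.Mh i.k i.P' μ = bigSide ℓ i.Mh s.1.1 * ((ℓ + 1) ^ (i.k - s.1.1) * i.P' μ) := by
      show (ℓ + 1) ^ i.k * ((ℓ + 1) * (i.Mh * i.P' μ)) = _
      unfold bigSide
      have hk : (ℓ + 1) ^ i.k = (ℓ + 1) ^ s.1.1 * (ℓ + 1) ^ (i.k - s.1.1) := by rw [← pow_add, Nat.add_sub_cancel' hjk]
      rw [hk]; ring
    rw [e]; push_cast; ring
  have hz := ((mem_boxDom.1 (blkCornerY i s).2) μ).2
  change (blkCornerY i s).1 μ < ((N0 ℓ i.Mh i.k i.P' μ : ℕ) : ℤ) at hz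
  rw [hN] at hz ⊢
  have hlt : blk (bigSide ℓ i.Mh s.1.1) (blkCornerY i s).1 μ < (((ℓ + 1) ^ (i.k - s.1.1) * i.P' μ : ℕ) : ℤ) := by
    show (blkCornerY i s).1 μ / ((bigSide ℓ i.Mh s.1.1 : ℕ) : ℤ) < _
    rw [Int.ediv_lt_iff_lt_mul hBpos]
    linarith
  nlinarith

/-- ★ LEVELS ARE CONSTANT ON BIG BLOCKS OF THEIR OWN LEVEL: if `lev c = j` and `w` lies in the same big `j`-block as `c`, then `lev w = j` ([4] (2.1) at levels
`j` — for `j ≥ 2` — and `j + 1`). [cite: Balaban1984PropagatorsII, (2.1) p.224, (2.3)–(2.4) p.224] -/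
theorem lev_eq_of_blk_bigSide_eq {w c : Fin (d + 1) → ℤ} (hw : w ∈ boxDom (N0 ℓ i.Mh i.k i.P')) (hc : c ∈ boxDom (N0 ℓ i.Mh i.k i.P')) {j : ℕ}
    (hlev : i.D.lev c = j) (h : blk (bigSide ℓ i.Mh j) w = blk (bigSide ℓ i.Mh j) c) : i.D.lev w = j := by
  have h1 : 1 ≤ i.D.lev w := i.D.one_le_lev w
  have hge : j ≤ i.D.lev w := by
    rcases Nat.lt_or_ge j 2 with hj | hj
    · omega
    · exact (i.D.bigBlocks j hj c hc w hw h).1 (hlev ▸ le_rfl)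
  have hle : i.D.lev w ≤ j := by
    by_contra hlt
    have h' : blk (bigSide ℓ i.Mh (j + 1)) w = blk (bigSide ℓ i.Mh (j + 1)) c := by
      rw [bigSide_succ, mul_comm, ← blk_blk, ← blk_blk, h]
    have hj2 : 2 ≤ j + 1 := by have := i.D.one_le_lev c; omega
    have := (i.D.bigBlocks (j + 1) hj2 c hc w hw h').2 (by omega)
    omega
  exact le_antisymm hle hge

end Coords

/-! ## §2 The torus cube of the big block -/

section Cube

variable (i : KIdx d ℓ hd hL b₀ b₁)

/-- the residue of the big corner coordinate is the coordinate. [cite: Balaban1985BackgroundPropagators, p.396 (cubes of the torus), dictionary] -/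
theorem val_bigCornerSite (s : BlkY i) (μ : Fin (d + 1)) :
    (((((((bigSide ℓ i.Mh s.1.1 : ℕ) : ℤ) * blk (bigSide ℓ i.Mh s.1.1) (blkCornerY i s).1 μ).toNat : ℕ) :
        ZMod ((PV d ℓ i.m i.K hd hL).sitesPerDir 0))).val : ℤ)
      = ((bigSide ℓ i.Mh s.1.1 : ℕ) : ℤ) * blk (bigSide ℓ i.Mh s.1.1) (blkCornerY i s).1 μ := by
  have h0 := bigCorner_nonneg i s μ
  have hlt : (((bigSide ℓ i.Mh s.1.1 : ℕ) : ℤ) * blk (bigSide ℓ i.Mh s.1.1) (blkCornerY i s).1 μ).toNat < (PV d ℓ i.m i.K hd hL).sitesPerDir 0 := by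
    have h := bigCorner_add_side_le_N0 i s μ
    have hB : 1 ≤ bigSide ℓ i.Mh s.1.1 := one_le_bigSide (le_trans (by norm_num) i.hM8) _
    rw [← i.hN μ]
    omega
  rw [ZMod.val_natCast, Nat.mod_eq_of_lt hlt, Int.toNat_of_nonneg h0]

/-- a torus point whose chart coordinates lie in the big box `[C, C + B)` lies in the torus cube of the big block.
[cite: Balaban1985BackgroundPropagators, p.396 (the cube class), dictionary] -/
theorem mem_bigCube_of_coord_bounds (s : BlkY i) (x : Site (PV d ℓ i.m i.K hd hL) 0)
    (h : ∀ μ, ((bigSide ℓ i.Mh s.1.1 : ℕ) : ℤ) * blk (bigSide ℓ i.Mh s.1.1) (blkCornerY i s).1 μ ≤ ((x μ).val : ℤ) ∧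
      ((x μ).val : ℤ) < ((bigSide ℓ i.Mh s.1.1 : ℕ) : ℤ) * blk (bigSide ℓ i.Mh s.1.1) (blkCornerY i s).1 μ + ((bigSide ℓ i.Mh s.1.1 : ℕ) : ℤ)) :
    x ∈ torusCube (fun μ => (((((bigSide ℓ i.Mh s.1.1 : ℕ) : ℤ) * blk (bigSide ℓ i.Mh s.1.1) (blkCornerY i s).1 μ).toNat : ℕ) :
        ZMod ((PV d ℓ i.m i.K hd hL).sitesPerDir 0))) (bigSide ℓ i.Mh s.1.1) := by
  intro μ
  have hv := val_bigCornerSite i s μ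
  obtain ⟨h1, h2⟩ := h μ
  have hle : ((((((bigSide ℓ i.Mh s.1.1 : ℕ) : ℤ) * blk (bigSide ℓ i.Mh s.1.1) (blkCornerY i s).1 μ).toNat : ℕ) :
      ZMod ((PV d ℓ i.m i.K hd hL).sitesPerDir 0))).val ≤ (x μ).val := by
    have : (((((((bigSide ℓ i.Mh s.1.1 : ℕ) : ℤ) * blk (bigSide ℓ i.Mh s.1.1) (blkCornerY i s).1 μ).toNat : ℕ) :
        ZMod ((PV d ℓ i.m i.K hd hL).sitesPerDir 0))).val : ℤ) ≤ ((x μ).val : ℤ) := by rw [hv]; exact h1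
    exact_mod_cast this
  show (x μ - _).val < bigSide ℓ i.Mh s.1.1
  rw [ZMod.val_sub hle]
  have h2' : ((x μ).val : ℤ) < ((((((((bigSide ℓ i.Mh s.1.1 : ℕ) : ℤ) * blk (bigSide ℓ i.Mh s.1.1) (blkCornerY i s).1 μ).toNat : ℕ) :
      ZMod ((PV d ℓ i.m i.K hd hL).sitesPerDir 0))).val : ℕ) : ℤ) + bigSide ℓ i.Mh s.1.1 := by
    rw [hv]; exact h2
  omega

/-- conversely the chart coordinates of a point of the torus cube lie in the big box. [cite: Balaban1985BackgroundPropagators, p.396 (the cube class), dictionary] -/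
theorem coord_bounds_of_mem_bigCube (s : BlkY i) {x : Site (PV d ℓ i.m i.K hd hL) 0}
    (hx : x ∈ torusCube (fun μ => (((((bigSide ℓ i.Mh s.1.1 : ℕ) : ℤ) * blk (bigSide ℓ i.Mh s.1.1) (blkCornerY i s).1 μ).toNat : ℕ) :
        ZMod ((PV d ℓ i.m i.K hd hL).sitesPerDir 0))) (bigSide ℓ i.Mh s.1.1)) (μ : Fin (d + 1)) :
    ((bigSide ℓ i.Mh s.1.1 : ℕ) : ℤ) * blk (bigSide ℓ i.Mh s.1.1) (blkCornerY i s).1 μ ≤ ((x μ).val : ℤ) ∧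
      ((x μ).val : ℤ) < ((bigSide ℓ i.Mh s.1.1 : ℕ) : ℤ) * blk (bigSide ℓ i.Mh s.1.1) (blkCornerY i s).1 μ + ((bigSide ℓ i.Mh s.1.1 : ℕ) : ℤ) := by
  set c₀ : ZMod ((PV d ℓ i.m i.K hd hL).sitesPerDir 0) :=
    (((((bigSide ℓ i.Mh s.1.1 : ℕ) : ℤ) * blk (bigSide ℓ i.Mh s.1.1) (blkCornerY i s).1 μ).toNat : ℕ) : ZMod ((PV d ℓ i.m i.K hd hL).sitesPerDir 0))
    with hc₀
  have hv : ((c₀.val : ℕ) : ℤ) = ((bigSide ℓ i.Mh s.1.1 : ℕ) : ℤ) * blk (bigSide ℓ i.Mh s.1.1) (blkCornerY i s).1 μ := val_bigCornerSite i s μ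
  have ht : (x μ - c₀).val < bigSide ℓ i.Mh s.1.1 := hx μ
  have hN : ((c₀.val : ℕ) : ℤ) + bigSide ℓ i.Mh s.1.1 ≤ (((PV d ℓ i.m i.K hd hL).sitesPerDir 0 : ℕ) : ℤ) := by
    rw [hv, ← i.hN μ]; exact bigCorner_add_side_le_N0 i s μ
  have hxeq : x μ = c₀ + (x μ - c₀) := by abel
  have hval : (x μ).val = c₀.val + (x μ - c₀).val := by
    conv_lhs => rw [hxeq]
    rw [ZMod.val_add, Nat.mod_eq_of_lt]
    zify; omega
  refine ⟨?_, ?_⟩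
  · rw [← hv]; exact_mod_cast (hval ▸ Nat.le_add_right _ _ : c₀.val ≤ (x μ).val)
  · zify at ht
    rw [hval]; push_cast; rw [hv] at *; linarith

/-- ★ every point of the big cube of `s` has level `j(s)`. [cite: Balaban1984PropagatorsII, (2.1) p.224; Balaban1985BackgroundPropagators, p.396 («□ ⊂ Bʲ(Λ_j) ∪ B^{j+1}(Λ_{j+1})»)] -/
theorem levV1_eq_of_mem_bigCube (s : BlkY i) {x : Site (PV d ℓ i.m i.K hd hL) 0}
    (hx : x ∈ torusCube (fun μ => (((((bigSide ℓ i.Mh s.1.1 : ℕ) : ℤ) * blk (bigSide ℓ i.Mh s.1.1) (blkCornerY i s).1 μ).toNat : ℕ) :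
        ZMod ((PV d ℓ i.m i.K hd hL).sitesPerDir 0))) (bigSide ℓ i.Mh s.1.1)) :
    levV1 i x = s.1.1 := by
  have hB : blk (bigSide ℓ i.Mh s.1.1) (toBox i.hN x).1 = blk (bigSide ℓ i.Mh s.1.1) (blkCornerY i s).1 := by
    funext μ
    obtain ⟨h1, h2⟩ := coord_bounds_of_mem_bigCube i s hx μ
    have hBpos : (0 : ℤ) < ((bigSide ℓ i.Mh s.1.1 : ℕ) : ℤ) := by
      have := one_le_bigSide (ℓ := ℓ) (le_trans (by norm_num) i.hM8) s.1.1; exact_mod_cast this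
    show ((x μ).val : ℤ) / ((bigSide ℓ i.Mh s.1.1 : ℕ) : ℤ) = blk (bigSide ℓ i.Mh s.1.1) (blkCornerY i s).1 μ
    set q := blk (bigSide ℓ i.Mh s.1.1) (blkCornerY i s).1 μ
    have e : ((x μ).val : ℤ) = (((x μ).val : ℤ) - ((bigSide ℓ i.Mh s.1.1 : ℕ) : ℤ) * q) + q * ((bigSide ℓ i.Mh s.1.1 : ℕ) : ℤ) := by ring
    rw [e, Int.add_mul_ediv_right _ _ hBpos.ne', Int.ediv_eq_zero_of_lt (by linarith) (by linarith), zero_add]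
  have hlevc : i.D.lev (blkCornerY i s).1 = s.1.1 := lev_eq_of_blkOf_eq i.D.toDomains (blkOf_corner i.D.toDomains s)
  exact lev_eq_of_blk_bigSide_eq i (toBox i.hN x).2 (blkCornerY i s).2 hlevc hB

/-- ★★ **THE BIG BLOCK OF A BLOCK OF `𝔅` IS A CLASS CUBE OF ITS OWN INDEX** (p. 396's class, def-Y's `cubeClass396`, `n = 1` big block).
[cite: Balaban1985BackgroundPropagators, p.396 (the cube class); Balaban1984PropagatorsII, (2.1) p.224] -/
theorem bigCube_mem_cubeClass396 (s : BlkY i) :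
    (torusCube (fun μ => (((((bigSide ℓ i.Mh s.1.1 : ℕ) : ℤ) * blk (bigSide ℓ i.Mh s.1.1) (blkCornerY i s).1 μ).toNat : ℕ) :
        ZMod ((PV d ℓ i.m i.K hd hL).sitesPerDir 0))) (bigSide ℓ i.Mh s.1.1), s.1.1) ∈ cubeClass396 i := by
  obtain ⟨hj1, hjk⟩ := scale_bounds i.D.toDomains s
  refine bigBlock_mem_cubeClass396 i hj1 hjk _ (fun μ => ?_) ?_ (fun x hx => levV1_eq_of_mem_bigCube i s hx)
  · -- divisibility of the corner residues by `B`
    have hv := val_bigCornerSite i s μ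
    have h0 : 0 ≤ blk (bigSide ℓ i.Mh s.1.1) (blkCornerY i s).1 μ :=
      Int.ediv_nonneg (((mem_boxDom.1 (blkCornerY i s).2) μ).1) (by positivity)
    refine ⟨(blk (bigSide ℓ i.Mh s.1.1) (blkCornerY i s).1 μ).toNat, ?_⟩
    zify
    rw [hv, Int.toNat_of_nonneg h0]
  · -- `B < N₀ = bigSide k · P′`, `P′ ≥ 5`
    rw [← i.hN 0, N0_eq_bigSide_mul]
    have hP : 5 ≤ i.P' 0 := i.hP5 0
    have hmono : bigSide ℓ i.Mh s.1.1 ≤ bigSide ℓ i.Mh i.k := by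
      unfold bigSide; exact Nat.mul_le_mul_left _ (Nat.pow_le_pow_right (Nat.succ_pos ℓ) (by omega))
    have hpos : 1 ≤ bigSide ℓ i.Mh i.k := one_le_bigSide (le_trans (by norm_num) i.hM8) _
    nlinarith

/-- sites of `s` chart into the big cube. [cite: Balaban1985BackgroundPropagators, p.396, dictionary] -/
theorem symm_mem_bigCube_of_blkOf {z : SiteY i} {s : BlkY i} (h : blkOf i.D.toDomains z = s) :
    (boxEquiv i.hN).symm z ∈ torusCube (fun μ => (((((bigSide ℓ i.Mh s.1.1 : ℕ) : ℤ) * blk (bigSide ℓ i.Mh s.1.1) (blkCornerY i s).1 μ).toNat : ℕ) :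
        ZMod ((PV d ℓ i.m i.K hd hL).sitesPerDir 0))) (bigSide ℓ i.Mh s.1.1) := by
  refine mem_bigCube_of_coord_bounds i s _ fun μ => ?_
  rw [val_boxEquiv_symm]
  exact bigCoord_bounds_of_blkOf i h μ

end Cube

/-! ## §3 The (3.35) gauge on the cube: every bond with both ends in the cube is near `1` and a contraction pair -/

section Gauge

open scoped Matrix.Norms.L2Operator

variable (i : KIdx d ℓ hd hL b₀ b₁) {N : ℕ}

/-- the value of the one-bond fluctuation unit: `e^{iηA_μ(x)}`. [cite: Balaban1985BackgroundPropagators, (3.35) p.396 («U^u = e^{iηA}»), dictionary] -/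
theorem val_fluct_eq_exp (η : ℝ) (A : Fin (PV d ℓ i.m i.K hd hL).d → Site (PV d ℓ i.m i.K hd hL) 0 → Matrix (Fin N) (Fin N) ℂ)
    (μ : Fin (PV d ℓ i.m i.K hd hL).d) (x : Site (PV d ℓ i.m i.K hd hL) 0) :
    ((fluct η A μ x : (Matrix (Fin N) (Fin N) ℂ)ˣ) : Matrix (Fin N) (Fin N) ℂ) = NormedSpace.exp (((Complex.I * η : ℂ)) • A μ x) := by
  simp [fluct, Beta.TransportVertices.holonomy]

/-- `|e^{iηA} − 1| ≤ e^{η|A|} − 1 ≤ e^{b} − 1` for `η|A| ≤ b`. [cite: Balaban1985BackgroundPropagators, (3.35) p.396, bookkeeping] -/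
theorem norm_fluct_sub_one_le {η : ℝ} (hη : 0 ≤ η) (A : Fin (PV d ℓ i.m i.K hd hL).d → Site (PV d ℓ i.m i.K hd hL) 0 → Matrix (Fin N) (Fin N) ℂ)
    (μ : Fin (PV d ℓ i.m i.K hd hL).d) (x : Site (PV d ℓ i.m i.K hd hL) 0) {b : ℝ} (hb : η * ‖A μ x‖ ≤ b) :
    ‖((fluct η A μ x : (Matrix (Fin N) (Fin N) ℂ)ˣ) : Matrix (Fin N) (Fin N) ℂ) - 1‖ ≤ Real.exp b - 1 := by
  rw [val_fluct_eq_exp]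
  have h := Literature.Analysis.Calculus.norm_exp_sub_one_le (((Complex.I * η : ℂ)) • A μ x)
  have hn : ‖((Complex.I * η : ℂ)) • A μ x‖ = η * ‖A μ x‖ := by
    rw [norm_smul, norm_mul, Complex.norm_I, one_mul, Complex.norm_real, Real.norm_of_nonneg hη]
  rw [hn] at h
  exact h.trans (sub_le_sub_right (Real.exp_le_exp.2 hb) 1)

variable {G : Subgroup (Matrix (Fin N) (Fin N) ℂ)ˣ}

/-- norm of a `G`-valued unit, `G ≤ U(N)`: `≤ 1`. [cite: Balaban1985BackgroundPropagators, (3.35) p.396 (U ∈ G), bookkeeping] -/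
private theorem norm_le_one_of_mem (hG : G ≤ B7Prop2Explicit.unitaryUnits (Matrix (Fin N) (Fin N) ℂ)) {g : (Matrix (Fin N) (Fin N) ℂ)ˣ} (hg : g ∈ G) :
    ‖(g : Matrix (Fin N) (Fin N) ℂ)‖ ≤ 1 := by
  rcases subsingleton_or_nontrivial (Matrix (Fin N) (Fin N) ℂ) with h | h
  · rw [Subsingleton.elim (g : Matrix (Fin N) (Fin N) ℂ) 0, norm_zero]; exact zero_le_one
  · exact (CStarRing.norm_of_mem_unitary (B7Prop2Explicit.mem_unitaryUnits.1 (hG hg))).le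

/-- ★★★ **THE (3.35) GAUGE ON A CUBE, PER BOND**: for the datum `(u, A)` of `Reg335Cube` on a cube (scale `ξ`, constant `C`, `0 < η`) and a `G`-valued `U`,
`G ≤ U(N)`: every bond `⟨x, x + e_μ⟩` with BOTH ends in the cube has `|U^u(b) − 1| ≤ e^{C·(η∕ξ)} − 1`, `|U^u(b)| ≤ 1`, `|U^u(b)⁻¹| ≤ 1`.
[cite: Balaban1985BackgroundPropagators, (3.35) p.396, (3.28) p.395] -/
theorem gauged_bond_near_one_of_reg335Cube (hG : G ≤ B7Prop2Explicit.unitaryUnits (Matrix (Fin N) (Fin N) ℂ)) {U : CfgY (Matrix (Fin N) (Fin N) ℂ) i}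
    (hU : ∀ μ x, U μ x ∈ G) {cube : Set (Site (PV d ℓ i.m i.K hd hL) 0)} {η ξ C : ℝ} (hη : 0 < η)
    {u : Site (PV d ℓ i.m i.K hd hL) 0 → (Matrix (Fin N) (Fin N) ℂ)ˣ} {A : Fin (PV d ℓ i.m i.K hd hL).d → Site (PV d ℓ i.m i.K hd hL) 0 → Matrix (Fin N) (Fin N) ℂ}
    (hu : ∀ z ∈ cube, ‖(u z : Matrix (Fin N) (Fin N) ℂ)‖ ≤ 1 ∧ ‖(((u z)⁻¹ : (Matrix (Fin N) (Fin N) ℂ)ˣ) : Matrix (Fin N) (Fin N) ℂ)‖ ≤ 1)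
    (hgA : ∀ κ, ∀ z ∈ cube, B9Eq3117Current.gaugeTr (shiftsV1 _) u U κ z = fluct η A κ z)
    (hA : ∀ κ, ∀ z ∈ cube, ‖A κ z‖ < C * ξ⁻¹) (μ : Fin (d + 1)) {x : Site (PV d ℓ i.m i.K hd hL) 0} (hx : x ∈ cube) (hx' : x.shift μ ∈ cube) :
    ‖(gaugeY i u U μ x : Matrix (Fin N) (Fin N) ℂ) - 1‖ ≤ Real.exp (C * (η / ξ)) - 1 ∧ ‖(gaugeY i u U μ x : Matrix (Fin N) (Fin N) ℂ)‖ ≤ 1 ∧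
      ‖(((gaugeY i u U μ x)⁻¹ : (Matrix (Fin N) (Fin N) ℂ)ˣ) : Matrix (Fin N) (Fin N) ℂ)‖ ≤ 1 := by
  have hgauge : gaugeY i u U μ x = B9Eq3117Current.gaugeTr (shiftsV1 _) u U μ x := by
    rw [gaugeY_apply, B9Eq3117Current.gaugeTr_apply]; rfl
  have hux := hu x hx
  have hux' := hu _ hx'
  have hUx : ‖(U μ x : Matrix (Fin N) (Fin N) ℂ)‖ ≤ 1 := norm_le_one_of_mem hG (hU μ x)
  have hUx' : ‖(((U μ x)⁻¹ : (Matrix (Fin N) (Fin N) ℂ)ˣ) : Matrix (Fin N) (Fin N) ℂ)‖ ≤ 1 := norm_le_one_of_mem hG (G.inv_mem (hU μ x))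
  refine ⟨?_, ?_, ?_⟩
  · rw [hgauge, hgA μ x hx]
    refine norm_fluct_sub_one_le i hη.le A μ x ?_
    calc η * ‖A μ x‖ ≤ η * (C * ξ⁻¹) := mul_le_mul_of_nonneg_left (hA μ x hx).le hη.le
      _ = C * (η / ξ) := by ring
  · rw [gaugeY_apply, Units.val_mul, Units.val_mul]
    have h12 : ‖(u x : Matrix (Fin N) (Fin N) ℂ) * (U μ x : Matrix (Fin N) (Fin N) ℂ)‖ ≤ 1 :=
      (norm_mul_le _ _).trans (mul_le_one₀ hux.1 (norm_nonneg _) hUx)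
    exact (norm_mul_le _ _).trans (mul_le_one₀ h12 (norm_nonneg _) hux'.2)
  · rw [gaugeY_apply, mul_inv_rev, mul_inv_rev, inv_inv, Units.val_mul, Units.val_mul]
    have h12 : ‖(((U μ x)⁻¹ : (Matrix (Fin N) (Fin N) ℂ)ˣ) : Matrix (Fin N) (Fin N) ℂ) * (((u x)⁻¹ : (Matrix (Fin N) (Fin N) ℂ)ˣ) : Matrix (Fin N) (Fin N) ℂ)‖ ≤ 1 :=
      (norm_mul_le _ _).trans (mul_le_one₀ hUx' (norm_nonneg _) hux.2)
    exact (norm_mul_le _ _).trans (mul_le_one₀ hux'.1 (norm_nonneg _) h12)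

/-- ★★★ **THE (3.35) GAUGE OF THE BIG CUBE OF A BLOCK OF `𝔅`**: for `U` in def-Y's class `(bg9K (M_N ℂ) G i).Reg335 c α₀` (`G ≤ U(N)`)
and a block `s ∈ 𝔅` of level `j`, there is a gauge `u` on the torus such that, on the big cube `□ ⊇ s`: `u` is a contraction pair at every point, and every
bond `⟨x, x+e_μ⟩` with both ends in `□` has `|U^u(b) − 1| ≤ e^{(c·M·α₀)·L^{−j}} − 1`, `|U^u(b)| ≤ 1`, `|U^u(b)⁻¹| ≤ 1`.
[cite: Balaban1985BackgroundPropagators, (3.35) p.396, Thm 3.11 p.416 («Doing the gauge transformation we get U = e^{iηA} with A small»)] -/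
theorem exists_gauge_of_reg335_blk (hG : G ≤ B7Prop2Explicit.unitaryUnits (Matrix (Fin N) (Fin N) ℂ)) {U : CfgY (Matrix (Fin N) (Fin N) ℂ) i} {c α₀ : ℝ}
    (hreg : (bg9K (Matrix (Fin N) (Fin N) ℂ) G i).Reg335 c α₀ U) (s : BlkY i) :
    ∃ u : GaugeY (Matrix (Fin N) (Fin N) ℂ) i,
      (∀ x ∈ torusCube (fun μ => (((((bigSide ℓ i.Mh s.1.1 : ℕ) : ℤ) * blk (bigSide ℓ i.Mh s.1.1) (blkCornerY i s).1 μ).toNat : ℕ) :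
          ZMod ((PV d ℓ i.m i.K hd hL).sitesPerDir 0))) (bigSide ℓ i.Mh s.1.1),
        ‖(u x : Matrix (Fin N) (Fin N) ℂ)‖ ≤ 1 ∧ ‖(((u x)⁻¹ : (Matrix (Fin N) (Fin N) ℂ)ˣ) : Matrix (Fin N) (Fin N) ℂ)‖ ≤ 1) ∧
      ∀ (μ : Fin (d + 1)) (x : Site (PV d ℓ i.m i.K hd hL) 0),
        x ∈ torusCube (fun μ => (((((bigSide ℓ i.Mh s.1.1 : ℕ) : ℤ) * blk (bigSide ℓ i.Mh s.1.1) (blkCornerY i s).1 μ).toNat : ℕ) :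
          ZMod ((PV d ℓ i.m i.K hd hL).sitesPerDir 0))) (bigSide ℓ i.Mh s.1.1) →
        x.shift μ ∈ torusCube (fun μ => (((((bigSide ℓ i.Mh s.1.1 : ℕ) : ℤ) * blk (bigSide ℓ i.Mh s.1.1) (blkCornerY i s).1 μ).toNat : ℕ) :
          ZMod ((PV d ℓ i.m i.K hd hL).sitesPerDir 0))) (bigSide ℓ i.Mh s.1.1) →
        ‖(gaugeY i u U μ x : Matrix (Fin N) (Fin N) ℂ) - 1‖ ≤ Real.exp ((c * (kGeo i).M * α₀) * ((((ℓ + 1 : ℕ) : ℝ) ^ s.1.1)⁻¹)) - 1 ∧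
        ‖(gaugeY i u U μ x : Matrix (Fin N) (Fin N) ℂ)‖ ≤ 1 ∧ ‖(((gaugeY i u U μ x)⁻¹ : (Matrix (Fin N) (Fin N) ℂ)ˣ) : Matrix (Fin N) (Fin N) ℂ)‖ ≤ 1 := by
  have hU : ∀ μ x, U μ x ∈ G := hreg.1
  have hcube := hreg.2 _ (bigCube_mem_cubeClass396 i s)
  obtain ⟨u, A, hu, hgA, hA, -⟩ := hcube
  have hη : 0 < (kGeo i).eta := by
    show 0 < |i.cf|⁻¹; exact inv_pos.2 (abs_pos.2 i.hcf)
  have hratio : (kGeo i).eta / LatticeNorms.scaleLen (kGeo i).L (kGeo i).eta s.1.1 = ((((ℓ + 1 : ℕ) : ℝ) ^ s.1.1)⁻¹) := by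
    unfold LatticeNorms.scaleLen
    rw [div_mul_eq_div_div_swap, div_self hη.ne', one_div]
  refine ⟨u, hu, fun μ x hx hx' => ?_⟩
  have h := gauged_bond_near_one_of_reg335Cube i hG hU hη hu hgA hA μ hx hx'
  rwa [hratio] at h

end Gauge

end Literature.MathematicalPhysics.QuantumFieldTheory.Balaban1983to89.B9Thm31SiteCoerciveReg335CubeY
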